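import Mathlib
import HarnessLib
import HarnessLib.Audit
import Summits.Parity.Statement

/-!
Route: TwinMinorArcs

DORMANT since 2026-09-04T17:26:50Z (reconciler: no traction for 5 d (last activity statement-checked at 2026-08-30T16:31:07Z); parked, not closed — `ledger route dormant route-Parity-TwinMinorArcs --off` to reactivate) — unstaffed, not closed; items shared with open routes are served there. `ledger route dormant <id> --off` reactivates.

# Route TwinMinorArcs — Vinogradov for twin primes — minor-arc uniformity of tuple measures decides
the rank-one cluster part of Conj. 1.2

It suffices to show X = TupleMinorArcUniformity ∧ BoundedDickson ∧ RankOneTransference ∧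
ResidualLift (card vinogradov-for-twins,
conforming re-filing of the retired route VinogradovForTwins whose assembly stopped at Schur
triples). ANATOMY of Green–Tao's Conj. 1.2
along three axes: group the forms of a system into CLUSTERS (classes with proportional linear
parts); the count is then a
finite-complexity average of TUPLE MEASURES T_c(m) = ∏_{i∈c} Λ(a_i m + b_i). (1) BoundedDickson —
Hardy–Littlewood for every FIXED
one-dimensional system (the parity core; it pays the major arcs). (2) TupleMinorArcUniformity —
"Vinogradov for prime tuples": for every
fixed one-dimensional Φ, sup over the minor arcs of |Σ_{n≤N} ∏Λ(φ_i(n)) e(nα)| = o(N) (V;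
main-term-free, Selberg-ghost-free,
Siegel-insensitive; NECESSARY for GHL by support GHLForcesTwinUniformity; its twin instance
TwinMinorArcUniformity is rank 2 and its
bilinear engine TwinVinogradovInequality rank 3). (3) RankOneTransference (PROVABLE, XL): (1) ∧ (2)
give Conj. 1.2 for every system
whose clusters have bounded internal gaps and whose cluster configuration has Cauchy–Schwarz
complexity ≤ 1 — the target
RankOneClusterGHL (prime k-tuples in progressions, Schur triples / 3-APs of prime tuples,
Vinogradov's three primes in twin primes).
(4) ResidualLift — the declared GHL-hard residual RankOneClusterGHL → GeneralizedHardyLittlewood: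
the s ≥ 2 nil-tower for cluster
configurations of complexity ≥ 2 and the shift-uniformity lift U (Landau–Siegel-complete); not
addressed by this mechanism.
Lean: `TupleMinorArcUniformity ∧ BoundedDickson ∧ RankOneTransference ∧ ResidualLift`

## Assembly
The deciding theorem is pure logic and elaborates sorry-free in the planner's Sketch.lean (rc 0) and
in glue.lean:
`theorem closes (hV : TupleMinorArcUniformity) (hB : BoundedDickson) (hR : RankOneTransference) (hL
: ResidualLift) :
GeneralizedHardyLittlewood := hL (hR hV hB)`. All mathematics sits in the items: RankOneTransference
(provable, XL) carries
V ∧ BoundedDickson to the rank-one cluster family RankOneClusterGHL; ResidualLift is the declared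
GHL-hard residual (nil-tower + shift
lift). The twin-instance items (TwinMinorArcUniformity, TwinVinogradovInequality,
GHLForcesTwinUniformity, SchurTriplesReduction,
ThreeTwinPrimesReduction) are where the line is tested first; they are not hypotheses of `closes`.

Rationale: WHY THIS LINE. Green–Tao (GreenTao2010 §1, Def. 1.5–Lemma 1.6) prove Conj. 1.2 at finite complexity
and leave the infinite-complexity case, but an
infinite-complexity system is not simply "binary": its parallel classes carry tuple measures and the
CONFIGURATION of the classes has
its own Cauchy–Schwarz complexity, so beyond d = 1 the conjecture needs, besides the prime k-tuple
counts, exactly the uniformity of the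
tuple measures against characters (complexity 1) and nilsequences (complexity ≥ 2) — an input no
other route of this sub-problem
isolates (DicksonFibration reduces everything to the shift-UNIFORM d = 1 statement, which contains
the Landau–Siegel-complete lift;
the negatives index has nothing on additive twists). The linear level V is the additive analogue of
Vinogradov's estimate (tree,
proved: Literature.NumberTheory.Sieve.vinogradov_primeExpSumLog_bound), is provably NECESSARY for
the conjunct (additive-energy
system), and with the fixed-system Hardy–Littlewood counts is SUFFICIENT for the rank-one cluster
family by linear transference /
the circle method with the Green–Tao restriction estimate for tuple majorants (tree, proved:
Literature.NumberTheory.Sieve.GreenTao2006_envelopingSieve_extension_holds) — cf. MatomakiShao2017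
(three primes with p+2 ∈ P₂:
the sieve-weighted minor arcs) and BienvenuShaoTeravainen2023 (transference for finite-complexity
systems inside almost twin primes,
lower bounds). Imported areas: the Hardy–Littlewood–Vinogradov circle method and higher-order
Fourier analysis (transference,
complexity) applied one level up, with CLUSTERS as atoms; the proposed engine for V is bilinear
(double Heath-Brown opening leaving a
twisted determinant core Σ_{uv−mk=2} μ(m)μ(u)e(αmk) with a non-resonant linear phase along every
line — cancellation from the phase,
in the habitat of MatomakiRadziwillTao2020Fourier), not sieve-theoretic. What the line does NOT do
is said as loudly: BoundedDickson
(parity) and ResidualLift (nil-tower + U) are conceded, typed, and carried as explicit hypotheses of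
`closes`.

RANKED CRUXES. #0 RankOneClusterGHL (target) — Green–Tao Conj. 1.2 for the RANK-ONE CLUSTER family —
all d, t, L, B: non-degenerate Ψ with ‖Ψ‖_N ≤ L whose parallel classes have internal gaps ≤ B
(|a·ψ_i(0) − b·ψ_j(0)| ≤ B(|a|+|b|) whenever aψ̇_i = bψ̇_j, (a,b) ≠ 0) and whose cluster
configuration has Cauchy–Schwarz complexity ≤ 1 (for each i the forms NOT parallel to ψ_i split into
two classes A, Aᶜ such that no non-zero multiple of ψ̇_i is a ℤ-combination of the linear parts in
either class), over every convex K ⊆ [−N,N]^d, error ≤ εN^d. Contains every fixed d = 1 system in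
progressions (prime k-tuples; the clause is vacuous at d = 1), Schur triples / 3-APs of prime
tuples, Vinogradov's three primes in twin primes (constant M ≤ LN in a non-parallel direction);
excludes Goldbach (n, M−n) (gap M) and 4-APs of twins (complexity 2). The fragment of the Statement
this line decides from V ∧ BoundedDickson. (why it might fail: As a target it contains the k-tuple
asymptotics (BoundedDickson) and V; as a rendering, the inline gap / cluster-complexity clauses must
match GT Def. 1.5 at cluster level (refuter check on twin, corner, three-twins, Goldbach,
4-AP×{0,2}).) [GreenTao2010, HardyLittlewood1923, MatomakiShao2017, BienvenuShaoTeravainen2023]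
#2 TwinMinorArcUniformity (crux) — (V for twins, card vinogradov-for-twins) for every ε > 0 there
are Q > 0 and N₀ such that for all N ≥ N₀ and every α with |α − a/q| > Q/N for all 1 ≤ q ≤ Q, a ∈ ℤ:
|Σ_{n≤N} Λ(n)Λ(n+2) e(nα)| ≤ εN. Main-term-free; invariant under the Selberg–Bombieri reweighting 1
± λ(n)λ(n+2); Siegel-insensitive (an exceptional character biases T̂(a/q) by ≤ N q^{−1/2+o(1)},
Weil); NECESSARY for GHL (support GHLForcesTwinUniformity), so ¬V refutes the conjunct. Content by
range (Dirichlet, τ = N/Q): conductors Q < q ≤ (log N)^A ('twins carry no slowly-modulated bias':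
Σλ(n)λ(n+2)e(an/q)-type cancellation), and deep minor arcs (rank 3). [difficulty: open-problem] (why
it might fail: Two untreated ranges: deep minor arcs need twisted 2-point Möbius cancellation on
lines (no engine); conductors Q<q≤(log N)^A need the parity bias of twins to carry no slow FM
modulation mod q — beyond sieve axioms plus positivity, and beyond lossy bilinear bounds.)
[MatomakiShao2017, MatomakiRadziwillTao2020Fourier, GreenTao2006Restriction, VaughanHL1997,
doi:10.1007/s10474-010-0015-9]
#3 TwinVinogradovInequality (crux) — Vinogradov's inequality for the twin measure — the bilinear
ENGINE statement (log-lossy on purpose): there are B, C and c > 0 with |Σ_{n≤N} Λ(n)Λ(n+2)e(nα)| ≤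
C·N(log N)^B (q^{−c} + (q/N)^c) whenever N ≥ 2, 1 ≤ q ≤ N, (a,q) = 1, |α − a/q| ≤ q^{−2}; nontrivial
for (log N)^{B/c} ≤ q ≤ N(log N)^{−B/c}. Its natural proof is the card's double opening (Heath-Brown
/ Vaughan on BOTH von Mangoldt factors): every piece with a smooth variable ≥ x^δ or a Type-I/II
shape is standard, and the residue is the TWISTED DETERMINANT CORE Σ_{uv−mk=2, all four in
[x^δ,x^{1−δ}]} μ(m)β_kμ(u)γ_v e(αmk), a family of 2-point Möbius sums along lines (m, u) = (m₀+tv,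
u₀+tk) twisted by the linear phase αkv·t, non-resonant off a sparse set of lines — its layer-2
child. With a polylog-conductor statement it yields V (Two-layer plan); the t = 1 analogue is the
tree theorem vinogradov_primeExpSumLog_bound. [difficulty: open-problem] (why it might fail: Needs
2-point Möbius cancellation along pairs of dilated progressions with a linear twist, moduli up to
x^(1−δ), savings (log x)^(−A) summed over ≍x lines — no such theorem (MRT uniformity is 1-point,
interval-averaged); Matomäki–Shao reach it only for sieve-weighted almost-twins.) [Vaughan1977,
Heathbrown1982, MatomakiShao2017, MatomakiRadziwillTao2020Fourier, Nathanson1996,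
doi:10.1090/s0025-5718-00-01280-1]
#4 TupleMinorArcUniformity (crux) — V for EVERY tuple measure: for every fixed non-degenerate
one-dimensional system Φ = (a_i n + b_i)_{i<t}, t ≥ 1, and every ε > 0 there are Q, N₀ with |Σ_{n≤N}
∏_i Λ(a_i n + b_i) e(nα)| ≤ εN for all N ≥ N₀ and all α off the arcs |α − a/q| ≤ Q/N, q ≤ Q. t = 1
is Vinogradov–Vaughan (known, tree); Φ = twinPrimeSystem is rank 2; general Φ covers clusters such
as (ℓ, 2ℓ+1), tuples restricted to progressions and k-tuples — exactly the hypothesis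
RankOneTransference consumes (finitely many Φ per (t, L, B)). [deps: TwinMinorArcUniformity]
[difficulty: open-problem] (why it might fail: Same two gaps as rank 2 for every tuple; for t ≥ 3
the double opening becomes a t-fold opening whose core is a t-point twisted Möbius sum on a
determinantal variety of higher codimension — even less technology exists.) [GreenTao2010,
VaughanHL1997, MatomakiShao2017, BienvenuShaoTeravainen2023]
#5 BoundedDickson (crux) — Dickson–Hardy–Littlewood for every FIXED one-dimensional system: for
non-degenerate Φ : Fin t → AffLinForm 1 (t ≥ 1) and ε > 0, eventually in N, for every convex K ⊆
[−N,N] (an interval): |Σ_{n∈K} ∏Λ(φ_i(n)) − β_∞∏_pβ_p| ≤ εN. Bounded shifts only (Φ is fixed before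
N): prime k-tuples in progressions, twins, Sophie Germain pairs; NOT Goldbach and NOT shift-uniform
(DicksonFibration.DimOne ⊋ this; GHL → BoundedDickson is the planner's proved boundedDickson_of_GHL
in Sketch.lean). The parity core shared by every GHL route; here it pays the MAJOR ARCS and nothing
in this line attacks it. [difficulty: open-problem] (why it might fail: Contains the twin prime and
k-tuple asymptotics: open; sieve derivations are blocked by parity (Selberg; Bombieri ghost 1 ±
λ(n)λ(n+2)) and the circle method by minor-arc L² mass; conceded, not specific to this line.)
[HardyLittlewood1923, Dickson1904, GreenTao2010, Literature.Barriers.Parity.SelbergParityBarrier,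
Literature.Barriers.Parity.PrimePairParity, Literature.Barriers.Parity.CircleMethodBinaryBarrier]
#9 RankOneTransference (support) — TupleMinorArcUniformity → BoundedDickson → RankOneClusterGHL.
PROVABLE NOW (XL): (i) cluster decomposition — forms with proportional linear parts and bounded gaps
are one tuple measure T_c ∘ ℓ_c with ℓ_c primitive; finitely many tuple types for given (t, L, B);
(ii) T_c = T_c♯ + T_c♭ with T_c♯ the level-Q periodic (major-arc) model: BoundedDickson in
progressions makes T̂_c♭ small on major arcs, TupleMinorArcUniformity on minor arcs, so the U²-norm
of T_c♭ relative to its enveloping-sieve majorant tends to 0 (tree: uniformityNorm_ge_of_expSum;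
restriction GreenTao2006_envelopingSieve_extension_holds); (iii) complexity-1 generalised von
Neumann for the CLUSTER system with tuple majorants (Goldston–Yıldırım linear-forms asymptotics
survive bounded-gap parallel families after the W-trick because β_p = 1 + O(p^{−2})); (iv) main
term: lattice points in residue classes (GreenTao2010_latticePointsConvexBody_holds) and Σ over
residues of ∏_c local densities → ∏_pβ_p(Ψ) (tendsto_singularProductPartial_holds). Its
circle-method instances are SchurTriplesReduction and ThreeTwinPrimesReduction. [difficulty: XL]
[GreenTao2010, GreenTao2006Restriction, BienvenuShaoTeravainen2023, VaughanHL1997]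
#9 ResidualLift (support) — (RESIDUAL — GHL-hard, NOT addressed by this mechanism; filed so that
`closes` decides the sub-problem, D-0027 §2.1) RankOneClusterGHL → GeneralizedHardyLittlewood.
Content exactly: (a) the NIL-TOWER — cluster configurations of Cauchy–Schwarz complexity s ≥ 2
(4-APs of twins, …) need U^{s+1}-uniformity of tuple measures relative to their periodic models
('Möbius–nilsequences for prime tuples', triage flag F1), not implied by linear V; (b) the SHIFT
LIFT U — unbounded intra-cluster gaps: Goldbach (n, M−n), pairs (n, n+h) with h ≤ LN, i.e.
DicksonFibration.DimOne beyond BoundedDickson, Landau–Siegel-complete (MatomakiMerikoski2023 Thm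
1.3). True if GHL is; unprovable by anything here. [difficulty: open-problem] [GreenTao2010,
MatomakiMerikoski2023, GreenTao2012Mobius, Literature.Barriers.Parity.SiegelZeroPrimePairBarrier]
#9 GHLForcesTwinUniformity (support) — GeneralizedHardyLittlewood → TwinMinorArcUniformity (V is
NECESSARY; the route's kill-link to the summit). Plan: the additive-energy system (a, a+2, b, b+2,
c, c+2, a+b−c, a+b−c+2) on ℤ³ with K = {0 ≤ a, b, c ≤ N, 1 ≤ a+b−c ≤ N} (convex, size ≤ 16) is a GHL
instance counting ∫₀¹|T̂|⁴; the major arcs (GHL at d = 1 in progressions q ≤ Q with |β| ≤ Q/N by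
partial summation) contribute Σ_{q≤Q}Σ_a|c_T(a,q)|⁴ × singular integral → the full main term as Q →
∞ (local Parseval; tail by tendsto_singularProductPartial_holds), hence ∫_𝔪|T̂|⁴ ≤ (o(1) +
tail_Q)N³; and |T̂′| ≤ 2πN Σ_{n≤N}T(n) ≪ N² (twinSieve_selberg_bombieri_davenport_holds) turns
|T̂(α₀)| ≥ εN at a minor α₀ into ∫_𝔪|T̂|⁴ ≫ ε⁵N³ — contradiction for large N. [difficulty: L]
[GreenTao2010, VaughanHL1997, Literature.NumberTheory.Sieve.TwinSieveUpperBound]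
#9 SchurTriplesReduction (support) — BoundedDickson → TwinMinorArcUniformity → Conj. 1.2 for the
corner system Ψ = (n₁, n₁+2, n₂, n₂+2, n₁+n₂, n₁+n₂+2) over every convex K ⊆ [−N,N]² (Schur triples
x, y, x+y of lower twin primes, error ≤ εN²; the retired route's assembly, now the model instance of
RankOneTransference). Circle method: cells of side ηN, boundary cells by the crude bound
(Literature/NumberTheory/Sieve/LinearEquationsInPrimesCrudeBounds), interior cells = ∫ T̂_I T̂_J
conj T̂; major arcs from BoundedDickson for (qm+b, qm+b+2), q ≤ Q, by partial summation; 𝔖^{(Q)} →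
singularProduct Ψ (local Parseval for (x, y, x+y), tendsto_singularProductPartial_holds); minor arcs
|∫_𝔪| ≤ sup_𝔪|T̂|^θ ‖T̂_I‖₃‖T̂_J‖₃‖T̂‖_{3(1−θ)}^{1−θ} ≤ ε^θ C N² by V and the restriction bound
∫|T̂|^p ≪ N^{p−1}, p > 2 (GreenTao2006_envelopingSieve_extension_holds, H = {0,2}). [difficulty: L]
[VaughanHL1997, GreenTao2006Restriction, GreenTao2010, Nathanson1996]
#9 ThreeTwinPrimesReduction (support) — BoundedDickson → TwinMinorArcUniformity → Vinogradov's
three-primes theorem IN LOWER TWIN PRIMES with the Green–Tao asymptotic: for Ψ_M = (n₁, n₁+2, n₂,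
n₂+2, M−n₁−n₂, M−n₁−n₂+2) and K_M = {x, y ≥ 0, x+y ≤ M} ⊆ [−M,M]² (‖Ψ_M‖_M ≤ 12), |Σ_{n₁+n₂+n₃=M}
T(n₁)T(n₂)T(n₃) − (M²/2)·∏_pβ_p(Ψ_M)| ≤ εM² eventually (∏_pβ_p = 0 unless M ≡ 3 mod 6). ∫₀¹
T̂(α)³e(−Mα)dα: major arcs from BoundedDickson, minor arcs ≤ sup_𝔪|T̂|^θ ∫|T̂|^{3−θ} ≤ ε^θ C M² by V
+ restriction at p = 3 − θ > 2. The constant M ≤ LN sits in a non-parallel direction: an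
inhomogeneous member of RankOneClusterGHL, showing that the reach of V is orthogonal to the Siegel
axis (contrast Goldbach). MatomakiShao2017 prove the P₂-weighted version unconditionally.
[difficulty: L] [Vinogradov1937ThreePrimes, MatomakiShao2017, VaughanHL1997,
GreenTao2006Restriction]

TWO-LAYER PLAN. Foreseen glued splits (k ≤ 3, depth 1), none filed now. TwinMinorArcUniformity ⇐
TwinVinogradovInequality → PolylogConductorUniformity
→ TwinMinorArcUniformity, where PolylogConductorUniformity says: for every A and ε, eventually,
|Σ_{n≤N}Λ(n)Λ(n+2)e((a/q+β)n)| ≤ εN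
for all Q < q ≤ (log N)^A, (a,q) = 1, |β| ≤ 1/(qτ), τ = N/Q ('no slowly-modulated bias of twins';
Siegel-insensitive by Weil;
the twins' analogue of the Siegel–Walfisz range, which for primes even Daboussi–Rivat's effective
bound does not avoid), and the glue
is Dirichlet's approximation theorem (Mathlib Real.exists_int_int_abs_mul_sub_le) with Q = Q(ε, B,
C, c). TwinVinogradovInequality ⇐
SmoothAndBilinearRanges (pieces of the double opening with a smooth variable ≥ x^δ or a Type-I/II
shape; geometric series, large
sieve) → TwistedDeterminantCore (card Crux 1: Σ_{(k,v)}|β_kγ_v|·|Σ_t μ(m₀+tv)μ(u₀+tk)e(αkv·t)| =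
o(x(log x)^{−C}) uniformly on the deep
minor arcs, resonant lines ‖αkv‖ < x^{−1+δ′} excised by the trivial bound) →
TwinVinogradovInequality. RankOneTransference ⇐
ClusterDecomposition → LinearGvNForClusters → MainTermFromResidues, if a prover asks. No split of
BoundedDickson is proposed here
(other routes own it).

KILL CRITERIA. ¬TwinMinorArcUniformity (an ε₀ > 0 and, for every Q, minor-arc values ≥ ε₀N for
infinitely many N) closes the route
`refuted:TwinMinorArcUniformity` AND — via GHLForcesTwinUniformity, provable now — refutes the
conjunct GeneralizedHardyLittlewood and the
summit Parity: hand the witness up. ¬TwinVinogradovInequality alone (e.g. incompatibility of any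
power-of-q saving with a proved
irregularity theorem) forces a pivot of rank 3 to the rate-free deep-minor-arc form (sup over q ∈
[N^δ, N^{1−δ}] = o(N)); the route
survives on V. ¬BoundedDickson or ¬TupleMinorArcUniformity refute GHL outright (both are
consequences of it). A refuter showing the
target mis-rendered (the inline gap or cluster-complexity clause admits a Goldbach-type pair or a
complexity-2 configuration, or
rejects the corner system) ⇒ ONE restate edit of RankOneClusterGHL + RankOneTransference +
ResidualLift (closes keeps its shape).
RankOneTransference refuted AS STATED (linear uniformity insufficient for some complexity-1 cluster
configuration) ⇒ shrink the target
to the circle-method family (k cluster forms tied by one linear relation); SchurTriplesReduction /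
ThreeTwinPrimesReduction survive
unchanged. DicksonFibration.DimOne proved elsewhere ⇒ the route is moot as a route (close
superseded) but V stays a theorem target and
GHLForcesTwinUniformity a lemma.

NOT DECOMPOSED YET. The twisted determinant core itself (its coefficient classes depend on the exact
identity and on how resonant lines are excised —
layer-2 child of rank 3); PolylogConductorUniformity (layer-2 child of rank 2); the s ≥ 2 nil-tower
('Möbius–nilsequences for tuple
measures' — a different thesis; it would shrink ResidualLift to U alone); inside
RankOneTransference: the W-trick for clusters, the
Goldston–Yıldırım linear-forms estimate for bounded-gap parallel families, restriction for NON-monic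
clusters (GT2006 Prop. 4.2 is
vendored for monic tuples only), the cell/boundary bookkeeping; the general-L uniformity (finitely
many Φ per (t, L, B) makes 'fixed Φ'
and 'uniform over bounded height' equivalent — a two-line lemma for the prover); numerics (below).

CHEAPEST FALSIFIER. (1) Rendering check of the target's two inline clauses on five systems (Lean,
`decide`-style): twinPrimeSystem (in; clause vacuous
at d = 1), corner system (in), three-twins Ψ_M (in: gap 2|a|, singleton third cluster), Goldbach (n,
M−n) (out for M > 2B: a = 1,
b = −1 gives gap M), fourAPSystem × {0,2} (out: for ψ = x the parts (1,1),(1,2),(1,3) cannot be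
2-coloured with both spans missing
(1,0)) — done by hand (NOTES.md); a refuter should redo it mechanically. (2) kit numerics (not run;
planners here are compute-free):
x = 10⁷…10⁸, max over 10⁴ minor-arc α (Q = 30) of |Σ_{p,p+2≤x} log p·log(p+2)·e(αp)|/x, and the same
at α = a/q for primes
q ∈ [50, 5000]: square-root size supports V; a plateau ≍ x at conductors q ~ (log x)^A would be
alarming for the polylog range.
(3) Literature: if MatomakiShao2017 §§6–8 or Tolev bound the GENUINE Λ(n)Λ(n+2) minor arcs
conditionally on twins in
progressions, rank 3 drops to known-conditional (route survives); if BienvenuShaoTeravainen2023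
already give an ASYMPTOTIC
transference for tuple measures under V-type hypotheses, RankOneTransference drops to known (good
news).

NUMBERS. Vinogradov–Vaughan for primes (tree, PROVED:
Literature.NumberTheory.Sieve.vinogradov_primeExpSumLog_bound; Nathanson1996 Thm 8.5):
|Σ_{p≤N} log p·e(pα)| ≤ 1552(Nq^{−1/2} + N^{4/5} + N^{1/2}q^{1/2})(log N)⁴ — rank 3 asks for ANY c >
0 and any B for the twin
measure. Daboussi–Rivat Thm 1 (doi:10.1090/s0025-5718-00-01280-1, p. 432, read): effective but still
(log x)^{3/4}(log log x)^{1/2}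
x/√q-lossy — even for primes the conductors q ≤ (log x)^{3/2} are paid by Siegel–Walfisz, which
twins lack (hence the foreseen split
of V). Green–Tao restriction (tree, PROVED, monic tuples): all p > 2, R^{10} ≤ N. Sieve mass:
Σ_{n≤N}Λ(n)Λ(n+2) ≤ (4 + o(1))·2C₂N
(tree twinSieve_selberg_bombieri_davenport_holds; 3.29956 BFI-type constants also in tree).
Almost-twin minor arcs: MatomakiShao2017
Thm 1.1 (p_i + 2 ∈ P₂); finite-complexity systems inside almost twin primes:
BienvenuShaoTeravainen2023 Thm 1.1 (relative lower
bounds). Negatives index at filing: 2 statements (a level-one convolution-moment sieve axiom;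
RectangleChowla as quantified), neither
about additive twists. Items at open: 11 (1 target, 4 cruxes, 5 supports, 1 assembly).

DEFINITION REQUESTS. One, filed right after open (`ledger workitem add --kind definition --notion
ClusterComplexity --topic Literature/NumberTheory/Sieve
--for <RankOneClusterGHL item>`): Green–Tao's Cauchy–Schwarz complexity s of a system (GreenTao2010
Def. 1.5) and its CLUSTER-LEVEL
variant (complexity of the system of primitive forms underlying the parallel classes, plus the
intra-cluster gap), so that the target's
two inline clauses can be restated as `clusterGap Ψ ≤ B ∧ clusterComplexity Ψ ≤ 1` over a vetted
Literature definition (the tree has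
only IsFiniteComplexitySystem = 'no two linear parts parallel'). No cite facts are needed: every
named input of the supports is PROVED
in the tree (vinogradov_primeExpSumLog_bound, GreenTao2006_envelopingSieve_extension_holds,
tendsto_singularProductPartial_holds,
GreenTao2010_latticePointsConvexBody_holds, uniformityNorm_ge_of_expSum,
twinSieve_selberg_bombieri_davenport_holds); imports = []
(all item statements are over Mathlib + Literature.NumberTheory.Sieve.LinearEquationsInPrimes, which
the Statement brings).

Novelty: Searches (2026-08-15, 18:45–19:10Z): `lit search --source crossref "Vinogradov theorem twin primes"`
(15: MatomakiShao2017
doi:10.1112/s0010437x17007072, Shao2014 doi:10.1215/00127094-2410176, Kontorovich pseudo-twins,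
Korevaar — none on genuine-twin minor
arcs); `… "exponential sums over twin primes sieve minor arcs"` (15: Buttkewitz
doi:10.1007/s10474-010-0015-9, Daboussi
doi:10.1006/jnth.2001.2639, Mikawa 2000, MaierSankaranarayanan2009, Ramaré–Viswanadham 2023 —
exponential sums over PRIMES only);
`… "Daboussi Rivat explicit upper bounds"` (→ doi:10.1090/s0025-5718-00-01280-1, read pp. 431–432);
`… "transference principle systems
of linear equations almost twin primes"` (→ BienvenuShaoTeravainen2023 doi:10.2140/ant.2023.17.231);
`lit galaxy search --star all`
×3 ("exponential sums over twin primes" 0 hits; "almost twin primes" 2: arXiv:1912.12572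
Piatetski-Shapiro three primes, ETDS 2025;
"arithmetic progressions of twin primes" 1: arXiv:1305.0348 Benatar); local searchd / hybrid /
OpenAlex / arXiv cascades DOWN or
rate-limited this session (recorded in NOTES.md); `ledger negatives --problem Parity` (2,
unrelated); the 23 route files of the sub
(only the retired VinogradovForTwins / MinorArcDecorrelation touch additive phases; none types
tuple-measure uniformity as a GHL input)
and the card's own triage record (refuter-6: KEEP, flags F1–F4, all four acted on here).
Nearest prior art found: MatomakiShao2017 (minor arcs for SIEVE-WEIGHTED almost twins inside
Vinogradov's th  [refs: 10.1112/s0010437x17007072, 10.1215/00127094-2410176, 10.1007/s10474-010-0015-9, 10.1006/jnth.2001.2639, 10.1090/s0025-5718-00-01280-1, 10.2140/ant.2023.17.231, 1912.12572, 1305.0348, doi:10.1112/s0010437x17007072, doi:10.1215/00127094-2410176, doi:10.1007/s10474-010-0015-9, doi:10.1006/jnth.2001.2639, doi:10.1090/s0025-5718-00-01280-1, doi:10.2140/ant.2023.17.231, MatomakiShao2017, Shao2014, Maier]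

Barriers (technique_class: fourier-uniformity-tuple-measures, twisted-determinant-core): - technique_class: fourier-uniformity-tuple-measures, twisted-determinant-core
- Literature.Barriers.Parity.CircleMethodBinaryBarrier: respected — no BINARY count is derived from
size bounds on an exponential sum; V is a size bound on the TUPLE-weighted sum used only for
configurations of cluster-complexity ≤ 1 in ≥ 2 cluster variables (ternary-or-better in the
clusters), with every binary count (BoundedDickson) imported as a hypothesis; the d = 1 content of
the target is BoundedDickson itself, untouched.
- Literature.Barriers.Parity.RedactedPrimes: same — the 'tight' major-arc information is a
hypothesis (tuples in progressions), never manufactured from loose L^∞ data; redacting twins changes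
BoundedDickson, which RankOneTransference consumes explicitly.
- Literature.Barriers.Parity.TrueComplexityBinary: respected and ORGANISING — no Gowers/Fourier norm
is applied across a parallel pair (n, n+2) (not_gowersControlsShift); uniformity is applied only
across the cluster configuration, where complexity ≤ 1 makes U² control a theorem; the complexity ≥
2 configurations are declared residual (nil-tower), not claimed.
- Literature.Barriers.Parity.CriticalDensityHalf: not met — no dense-model step forces tuples from
density; majorants enter only through restriction/linear-forms upper bounds, and the d = 1 slice
(infinite complexity by not_isFiniteComplexitySystem_dimOne_of_two_le) is the conceded crux
BoundedDickson.
- Literature.Barriers.Parity.SelbergParityBarrier: it does not evad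

History (route lifecycle, newest last):
- 2026-08-22T23:18:59Z · DORMANT — reconciler: no traction for 5.7 d (last activity item-evidence-added at 2026-08-17T04:46:51Z); parked, not closed — `ledger route dormant route-Parity-TwinMinor (operator:999:3037896)
- 2026-08-30T08:37:09Z · REACTIVATED — reconciler: reactivated — activity item-evidence-added at 2026-08-30T07:41:20Z after parking at 2026-08-22T23:18:59Z (operator:999:3791244)
- 2026-09-04T17:26:50Z · DORMANT — reconciler: no traction for 5 d (last activity statement-checked at 2026-08-30T16:31:07Z); parked, not closed — `ledger route dormant route-Parity-TwinMinorArcs (operator:999:1467260)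

sub-problem: GeneralizedHardyLittlewood · status: dormant · opened planner-plancard-Parity-GeneralizedHardyLittl-ab396bfa-g2-0 2026-08-15T19:00:30Z · rev 1 · ledger route-Parity-TwinMinorArcs
GENERATED by the gate from the ledger (D-0016/17). Provers cite these decls: `theorem foo : Summit.Parity.GeneralizedHardyLittlewood.Theses.TwinMinorArcs.<Decl> := …` in Summits/Parity/GeneralizedHardyLittlewood/Theorems/<Name>.lean.
-/

namespace Summit.Parity.GeneralizedHardyLittlewood.Theses.TwinMinorArcs

open scoped BigOperators Topology Manifold Classical MeasureTheory ProbabilityTheory Matrix InnerProductSpace ComplexConjugate ContinuousMap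
open Filter Set Function TopologicalSpace MeasureTheory

attribute [summit_statement] _root_.GeneralizedHardyLittlewood

/-- item stmt-Parity-13147 · target · rank 0 · open · by planner
why it might fail: As a target it contains the k-tuple asymptotics (BoundedDickson) and V; as a rendering, the inline gap / cluster-complexity clauses must match GT Def. 1.5 at cluster level (refuter check on twin, corner, three-twins, Goldbach, 4-AP×{0,2}).
sources: GreenTao2010, HardyLittlewood1923, MatomakiShao2017, BienvenuShaoTeravainen2023
[target] Green–Tao Conj. 1.2 for the RANK-ONE CLUSTER family — all d, t, L, B: non-degenerate Ψ with
‖Ψ‖_N ≤ L whose parallel classes have internal gaps ≤ B (|a·ψ_i(0) − b·ψ_j(0)| ≤ B(|a|+|b|) whenever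
aψ̇_i = bψ̇_j, (a,b) ≠ 0) and whose cluster configuration has Cauchy–Schwarz complexity ≤ 1 (for
each i the forms NOT parallel to ψ_i split into two classes A, Aᶜ such that no non-zero multiple of
ψ̇_i is a ℤ-combination of the linear parts in either class), over every convex K ⊆ [−N,N]^d, error
≤ εN^d. Contains every fixed d = 1 system in progressions (prime k-tuples; the clause is vacuous at
d = 1), Schur triples / 3-APs of prime tuples, Vinogradov's three primes in twin primes (constant M
≤ LN in a non-parallel direction); excludes Goldbach (n, M−n) (gap M) and 4-APs of twins (complexity
2). The fragment of the Statement this line decides from V ∧ BoundedDickson. -/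
@[route_item "route-Parity-TwinMinorArcs"]
def RankOneClusterGHL : Prop :=
  ∀ (d t L B : ℕ), 1 ≤ d → 1 ≤ t → ∀ ε : ℝ, 0 < ε → ∃ N₀ : ℕ, ∀ N : ℕ, N₀ ≤ N → ∀ Ψ : Fin t → Literature.NumberTheory.Sieve.AffLinForm d, Literature.NumberTheory.Sieve.IsNondegenerateSystem Ψ → Literature.NumberTheory.Sieve.affLinSize Ψ N ≤ L → (∀ i j : Fin t, ∀ a b : ℤ, (a ≠ 0 ∨ b ≠ 0) → a • (Ψ i).coeff = b • (Ψ j).coeff → |a * (Ψ i).const - b * (Ψ j).const| ≤ B * (|a| + |b|)) → (∀ i : Fin t, ∃ A : Finset (Fin t), ∀ S : Finset (Fin t), (S = A ∨ S = Aᶜ) → ∀ (m : ℤ) (c : Fin t → ℤ), m • (Ψ i).coeff = ∑ j ∈ S.filter (fun j => ∀ a b : ℤ, a • (Ψ j).coeff = b • (Ψ i).coeff → a = 0 ∧ b = 0), c j • (Ψ j).coeff → m = 0) → ∀ K : Set (Fin d → ℝ), Convex ℝ K → K ⊆ Literature.NumberTheory.Sieve.realBox d N → |Literature.NumberTheory.Sieve.vonMangoldtSum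 Ψ K N - Literature.NumberTheory.Sieve.archFactor Ψ K * Literature.NumberTheory.Sieve.singularProduct Ψ| ≤ ε * (N : ℝ) ^ d

/-- item stmt-Parity-13148 · crux · rank 2 · open · by planner
why it might fail: Two untreated ranges: deep minor arcs need twisted 2-point Möbius cancellation on lines (no engine); conductors Q<q≤(log N)^A need the parity bias of twins to carry no slow FM modulation mod q — beyond sieve axioms plus positivity, and beyond lossy bilinear bounds.
sources: MatomakiShao2017, MatomakiRadziwillTao2020Fourier, GreenTao2006Restriction, VaughanHL1997, doi:10.1007/s10474-010-0015-9
[crux] (V for twins, card vinogradov-for-twins) for every ε > 0 there are Q > 0 and N₀ such that for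
all N ≥ N₀ and every α with |α − a/q| > Q/N for all 1 ≤ q ≤ Q, a ∈ ℤ: |Σ_{n≤N} Λ(n)Λ(n+2) e(nα)| ≤
εN. Main-term-free; invariant under the Selberg–Bombieri reweighting 1 ± λ(n)λ(n+2);
Siegel-insensitive (an exceptional character biases T̂(a/q) by ≤ N q^{−1/2+o(1)}, Weil); NECESSARY
for GHL (support GHLForcesTwinUniformity), so ¬V refutes the conjunct. Content by range (Dirichlet,
τ = N/Q): conductors Q < q ≤ (log N)^A ('twins carry no slowly-modulated bias':
Σλ(n)λ(n+2)e(an/q)-type cancellation), and deep minor arcs (rank 3). [difficulty: open-problem] -/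
@[route_item "route-Parity-TwinMinorArcs"]
def TwinMinorArcUniformity : Prop :=
  ∀ ε : ℝ, 0 < ε → ∃ Q : ℝ, 0 < Q ∧ ∃ N₀ : ℕ, ∀ N : ℕ, N₀ ≤ N → ∀ α : ℝ, (∀ q : ℕ, 1 ≤ q → (q : ℝ) ≤ Q → ∀ a : ℤ, Q / N < |α - a / q|) → ‖∑ n ∈ Finset.Icc 1 N, ((ArithmeticFunction.vonMangoldt n * ArithmeticFunction.vonMangoldt (n + 2) : ℝ) : ℂ) * Complex.exp (2 * Real.pi * Complex.I * (α * n))‖ ≤ ε * N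

/-- item stmt-Parity-13149 · crux · rank 3 · open · by planner
why it might fail: Needs 2-point Möbius cancellation along pairs of dilated progressions with a linear twist, moduli up to x^(1−δ), savings (log x)^(−A) summed over ≍x lines — no such theorem (MRT uniformity is 1-point, interval-averaged); Matomäki–Shao reach it only for sieve-weighted almost-twins.
sources: Vaughan1977, Heathbrown1982, MatomakiShao2017, MatomakiRadziwillTao2020Fourier, Nathanson1996, doi:10.1090/s0025-5718-00-01280-1
[crux] Vinogradov's inequality for the twin measure — the bilinear ENGINE statement (log-lossy on
purpose): there are B, C and c > 0 with |Σ_{n≤N} Λ(n)Λ(n+2)e(nα)| ≤ C·N(log N)^B (q^{−c} + (q/N)^c)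
whenever N ≥ 2, 1 ≤ q ≤ N, (a,q) = 1, |α − a/q| ≤ q^{−2}; nontrivial for (log N)^{B/c} ≤ q ≤ N(log
N)^{−B/c}. Its natural proof is the card's double opening (Heath-Brown / Vaughan on BOTH von
Mangoldt factors): every piece with a smooth variable ≥ x^δ or a Type-I/II shape is standard, and
the residue is the TWISTED DETERMINANT CORE Σ_{uv−mk=2, all four in [x^δ,x^{1−δ}]} μ(m)β_kμ(u)γ_v
e(αmk), a family of 2-point Möbius sums along lines (m, u) = (m₀+tv, u₀+tk) twisted by the linear
phase αkv·t, non-resonant off a sparse set of lines — its layer-2 child. With a polylog-conductor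
statement it yields V (Two-layer plan); the t = 1 analogue is the tree theorem
vinogradov_primeExpSumLog_bound. [difficulty: open-problem] -/
@[route_item "route-Parity-TwinMinorArcs"]
def TwinVinogradovInequality : Prop :=
  ∃ (B : ℕ) (C c : ℝ), 0 < c ∧ ∀ N : ℕ, 2 ≤ N → ∀ (α : ℝ) (a : ℤ) (q : ℕ), 1 ≤ q → q ≤ N → Int.gcd a q = 1 → |α - a / q| ≤ 1 / (q : ℝ) ^ 2 → ‖∑ n ∈ Finset.Icc 1 N, ((ArithmeticFunction.vonMangoldt n * ArithmeticFunction.vonMangoldt (n + 2) : ℝ) : ℂ) * Complex.exp (2 * Real.pi * Complex.I * (α * n))‖ ≤ C * N * Real.log N ^ B * ((q : ℝ) ^ (-c) + ((q : ℝ) / N) ^ c)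

/-- item stmt-Parity-13150 · crux · rank 4 · open · by planner
why it might fail: Same two gaps as rank 2 for every tuple; for t ≥ 3 the double opening becomes a t-fold opening whose core is a t-point twisted Möbius sum on a determinantal variety of higher codimension — even less technology exists.
sources: GreenTao2010, VaughanHL1997, MatomakiShao2017, BienvenuShaoTeravainen2023
[crux] V for EVERY tuple measure: for every fixed non-degenerate one-dimensional system Φ = (a_i n +
b_i)_{i<t}, t ≥ 1, and every ε > 0 there are Q, N₀ with |Σ_{n≤N} ∏_i Λ(a_i n + b_i) e(nα)| ≤ εN for
all N ≥ N₀ and all α off the arcs |α − a/q| ≤ Q/N, q ≤ Q. t = 1 is Vinogradov–Vaughan (known, tree);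
Φ = twinPrimeSystem is rank 2; general Φ covers clusters such as (ℓ, 2ℓ+1), tuples restricted to
progressions and k-tuples — exactly the hypothesis RankOneTransference consumes (finitely many Φ per
(t, L, B)). [deps: TwinMinorArcUniformity] [difficulty: open-problem] -/
@[route_item "route-Parity-TwinMinorArcs"]
def TupleMinorArcUniformity : Prop :=
  ∀ (t : ℕ) (Φ : Fin t → Literature.NumberTheory.Sieve.AffLinForm 1), 1 ≤ t → Literature.NumberTheory.Sieve.IsNondegenerateSystem Φ → ∀ ε : ℝ, 0 < ε → ∃ Q : ℝ, 0 < Q ∧ ∃ N₀ : ℕ, ∀ N : ℕ, N₀ ≤ N → ∀ α : ℝ, (∀ q : ℕ, 1 ≤ q → (q : ℝ) ≤ Q → ∀ a : ℤ, Q / N < |α - a / q|) → ‖∑ n ∈ Finset.Icc 1 N, ((∏ i, Literature.NumberTheory.Sieve.intVonMangoldt ((Φ i).eval ![(n : ℤ)]) : ℝ) : ℂ) * Complex.exp (2 * Real.pi * Complex.I * (α * n))‖ ≤ ε * N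

/-- item stmt-Parity-13151 · crux · rank 5 · open · by planner
why it might fail: Contains the twin prime and k-tuple asymptotics: open; sieve derivations are blocked by parity (Selberg; Bombieri ghost 1 ± λ(n)λ(n+2)) and the circle method by minor-arc L² mass; conceded, not specific to this line.
sources: HardyLittlewood1923, Dickson1904, GreenTao2010, Literature.Barriers.Parity.SelbergParityBarrier, Literature.Barriers.Parity.PrimePairParity, Literature.Barriers.Parity.CircleMethodBinaryBarrier
[crux] Dickson–Hardy–Littlewood for every FIXED one-dimensional system: for non-degenerate Φ : Fin t
→ AffLinForm 1 (t ≥ 1) and ε > 0, eventually in N, for every convex K ⊆ [−N,N] (an interval):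
|Σ_{n∈K} ∏Λ(φ_i(n)) − β_∞∏_pβ_p| ≤ εN. Bounded shifts only (Φ is fixed before N): prime k-tuples in
progressions, twins, Sophie Germain pairs; NOT Goldbach and NOT shift-uniform
(DicksonFibration.DimOne ⊋ this; GHL → BoundedDickson is the planner's proved boundedDickson_of_GHL
in Sketch.lean). The parity core shared by every GHL route; here it pays the MAJOR ARCS and nothing
in this line attacks it. [difficulty: open-problem] -/
@[route_item "route-Parity-TwinMinorArcs"]
def BoundedDickson : Prop :=
  ∀ (t : ℕ) (Φ : Fin t → Literature.NumberTheory.Sieve.AffLinForm 1), 1 ≤ t → Literature.NumberTheory.Sieve.IsNondegenerateSystem Φ → ∀ ε : ℝ, 0 < ε → ∃ N₀ : ℕ, ∀ N : ℕ, N₀ ≤ N → ∀ K : Set (Fin 1 → ℝ), Convex ℝ K → K ⊆ Literature.NumberTheory.Sieve.realBox 1 N → |Literature.NumberTheory.Sieve.vonMangoldtSum Φ K N - Literature.NumberTheory.Sieve.archFactor Φ K * Literature.NumberTheory.Sieve.singularProduct Φ| ≤ ε * N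

/-- item stmt-Parity-13152 · support · rank 9 · open · by planner
sources: GreenTao2010, GreenTao2006Restriction, BienvenuShaoTeravainen2023, VaughanHL1997
[support] TupleMinorArcUniformity → BoundedDickson → RankOneClusterGHL. PROVABLE NOW (XL): (i)
cluster decomposition — forms with proportional linear parts and bounded gaps are one tuple measure
T_c ∘ ℓ_c with ℓ_c primitive; finitely many tuple types for given (t, L, B); (ii) T_c = T_c♯ + T_c♭
with T_c♯ the level-Q periodic (major-arc) model: BoundedDickson in progressions makes T̂_c♭ small
on major arcs, TupleMinorArcUniformity on minor arcs, so the U²-norm of T_c♭ relative to its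
enveloping-sieve majorant tends to 0 (tree: uniformityNorm_ge_of_expSum; restriction
GreenTao2006_envelopingSieve_extension_holds); (iii) complexity-1 generalised von Neumann for the
CLUSTER system with tuple majorants (Goldston–Yıldırım linear-forms asymptotics survive bounded-gap
parallel families after the W-trick because β_p = 1 + O(p^{−2})); (iv) main term: lattice points in
residue classes (GreenTao2010_latticePointsConvexBody_holds) and Σ over residues of ∏_c local
densities → ∏_pβ_p(Ψ) (tendsto_singularProductPartial_holds). Its circle-method instances are
SchurTriplesReduction and ThreeTwinPrimesReduction. [difficulty: XL] -/
@[route_item "route-Parity-TwinMinorArcs"]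
def RankOneTransference : Prop :=
  TupleMinorArcUniformity → BoundedDickson → RankOneClusterGHL

/-- item stmt-Parity-13153 · support · rank 9 · open · by planner
sources: GreenTao2010, MatomakiMerikoski2023, GreenTao2012Mobius, Literature.Barriers.Parity.SiegelZeroPrimePairBarrier
[support] (RESIDUAL — GHL-hard, NOT addressed by this mechanism; filed so that `closes` decides the
sub-problem, D-0027 §2.1) RankOneClusterGHL → GeneralizedHardyLittlewood. Content exactly: (a) the
NIL-TOWER — cluster configurations of Cauchy–Schwarz complexity s ≥ 2 (4-APs of twins, …) need
U^{s+1}-uniformity of tuple measures relative to their periodic models ('Möbius–nilsequences for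
prime tuples', triage flag F1), not implied by linear V; (b) the SHIFT LIFT U — unbounded
intra-cluster gaps: Goldbach (n, M−n), pairs (n, n+h) with h ≤ LN, i.e. DicksonFibration.DimOne
beyond BoundedDickson, Landau–Siegel-complete (MatomakiMerikoski2023 Thm 1.3). True if GHL is;
unprovable by anything here. [difficulty: open-problem] -/
@[route_item "route-Parity-TwinMinorArcs"]
def ResidualLift : Prop :=
  RankOneClusterGHL → GeneralizedHardyLittlewood

/-- item stmt-Parity-13154 · support · rank 9 · open · by planner
sources: GreenTao2010, VaughanHL1997, Literature.NumberTheory.Sieve.TwinSieveUpperBound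
[support] GeneralizedHardyLittlewood → TwinMinorArcUniformity (V is NECESSARY; the route's kill-link
to the summit). Plan: the additive-energy system (a, a+2, b, b+2, c, c+2, a+b−c, a+b−c+2) on ℤ³ with
K = {0 ≤ a, b, c ≤ N, 1 ≤ a+b−c ≤ N} (convex, size ≤ 16) is a GHL instance counting ∫₀¹|T̂|⁴; the
major arcs (GHL at d = 1 in progressions q ≤ Q with |β| ≤ Q/N by partial summation) contribute
Σ_{q≤Q}Σ_a|c_T(a,q)|⁴ × singular integral → the full main term as Q → ∞ (local Parseval; tail by
tendsto_singularProductPartial_holds), hence ∫_𝔪|T̂|⁴ ≤ (o(1) + tail_Q)N³; and |T̂′| ≤ 2πN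
Σ_{n≤N}T(n) ≪ N² (twinSieve_selberg_bombieri_davenport_holds) turns |T̂(α₀)| ≥ εN at a minor α₀ into
∫_𝔪|T̂|⁴ ≫ ε⁵N³ — contradiction for large N. [difficulty: L] -/
@[route_item "route-Parity-TwinMinorArcs"]
def GHLForcesTwinUniformity : Prop :=
  GeneralizedHardyLittlewood → TwinMinorArcUniformity

/-- item stmt-Parity-13155 · support · rank 9 · open · by planner
sources: VaughanHL1997, GreenTao2006Restriction, GreenTao2010, Nathanson1996
[support] BoundedDickson → TwinMinorArcUniformity → Conj. 1.2 for the corner system Ψ = (n₁, n₁+2,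
n₂, n₂+2, n₁+n₂, n₁+n₂+2) over every convex K ⊆ [−N,N]² (Schur triples x, y, x+y of lower twin
primes, error ≤ εN²; the retired route's assembly, now the model instance of RankOneTransference).
Circle method: cells of side ηN, boundary cells by the crude bound
(Literature/NumberTheory/Sieve/LinearEquationsInPrimesCrudeBounds), interior cells = ∫ T̂_I T̂_J
conj T̂; major arcs from BoundedDickson for (qm+b, qm+b+2), q ≤ Q, by partial summation; 𝔖^{(Q)} →
singularProduct Ψ (local Parseval for (x, y, x+y), tendsto_singularProductPartial_holds); minor arcs
|∫_𝔪| ≤ sup_𝔪|T̂|^θ ‖T̂_I‖₃‖T̂_J‖₃‖T̂‖_{3(1−θ)}^{1−θ} ≤ ε^θ C N² by V and the restriction bound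
∫|T̂|^p ≪ N^{p−1}, p > 2 (GreenTao2006_envelopingSieve_extension_holds, H = {0,2}). [difficulty: L] -/
@[route_item "route-Parity-TwinMinorArcs"]
def SchurTriplesReduction : Prop :=
  BoundedDickson → TwinMinorArcUniformity → ∀ ε : ℝ, 0 < ε → ∃ N₀ : ℕ, ∀ N : ℕ, N₀ ≤ N → ∀ K : Set (Fin 2 → ℝ), Convex ℝ K → K ⊆ Literature.NumberTheory.Sieve.realBox 2 N → |Literature.NumberTheory.Sieve.vonMangoldtSum (![⟨![1, 0], 0⟩, ⟨![1, 0], 2⟩, ⟨![0, 1], 0⟩, ⟨![0, 1], 2⟩, ⟨![1, 1], 0⟩, ⟨![1, 1], 2⟩] : Fin 6 → Literature.NumberTheory.Sieve.AffLinForm 2) K N - Literature.NumberTheory.Sieve.archFactor (![⟨![1, 0], 0⟩, ⟨![1, 0], 2⟩, ⟨![0, 1], 0⟩, ⟨![0, 1], 2⟩, ⟨![1, 1], 0⟩, ⟨![1, 1], 2⟩] : Fin 6 → Literature.NumberTheory.Sieve.AffLinForm 2) K * Literature.NumberTheory.Sieve.singularProduct (![⟨![1, 0], 0⟩, ⟨![1,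 0], 2⟩, ⟨![0, 1], 0⟩, ⟨![0, 1], 2⟩, ⟨![1, 1], 0⟩, ⟨![1, 1], 2⟩] : Fin 6 → Literature.NumberTheory.Sieve.AffLinForm 2)| ≤ ε * (N : ℝ) ^ 2

/-- item stmt-Parity-13156 · support · rank 9 · open · by planner
sources: Vinogradov1937ThreePrimes, MatomakiShao2017, VaughanHL1997, GreenTao2006Restriction
[support] BoundedDickson → TwinMinorArcUniformity → Vinogradov's three-primes theorem IN LOWER TWIN
PRIMES with the Green–Tao asymptotic: for Ψ_M = (n₁, n₁+2, n₂, n₂+2, M−n₁−n₂, M−n₁−n₂+2) and K_M =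
{x, y ≥ 0, x+y ≤ M} ⊆ [−M,M]² (‖Ψ_M‖_M ≤ 12), |Σ_{n₁+n₂+n₃=M} T(n₁)T(n₂)T(n₃) − (M²/2)·∏_pβ_p(Ψ_M)|
≤ εM² eventually (∏_pβ_p = 0 unless M ≡ 3 mod 6). ∫₀¹ T̂(α)³e(−Mα)dα: major arcs from
BoundedDickson, minor arcs ≤ sup_𝔪|T̂|^θ ∫|T̂|^{3−θ} ≤ ε^θ C M² by V + restriction at p = 3 − θ > 2.
The constant M ≤ LN sits in a non-parallel direction: an inhomogeneous member of RankOneClusterGHL,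
showing that the reach of V is orthogonal to the Siegel axis (contrast Goldbach). MatomakiShao2017
prove the P₂-weighted version unconditionally. [difficulty: L] -/
@[route_item "route-Parity-TwinMinorArcs"]
def ThreeTwinPrimesReduction : Prop :=
  BoundedDickson → TwinMinorArcUniformity → ∀ ε : ℝ, 0 < ε → ∃ M₀ : ℕ, ∀ M : ℕ, M₀ ≤ M → |Literature.NumberTheory.Sieve.vonMangoldtSum (![⟨![1, 0], 0⟩, ⟨![1, 0], 2⟩, ⟨![0, 1], 0⟩, ⟨![0, 1], 2⟩, ⟨![-1, -1], (M : ℤ)⟩, ⟨![-1, -1], (M : ℤ) + 2⟩] : Fin 6 → Literature.NumberTheory.Sieve.AffLinForm 2) {x : Fin 2 → ℝ | 0 ≤ x 0 ∧ 0 ≤ x 1 ∧ x 0 + x 1 ≤ M} M - Literature.NumberTheory.Sieve.archFactor (![⟨![1, 0], 0⟩, ⟨![1, 0], 2⟩, ⟨![0, 1], 0⟩, ⟨![0, 1], 2⟩, ⟨![-1, -1], (M : ℤ)⟩, ⟨![-1, -1], (M : ℤ) + 2⟩] : Fin 6 → Literature.NumberTheory.Sieve.AffLinForm 2) {x : Fin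 2 → ℝ | 0 ≤ x 0 ∧ 0 ≤ x 1 ∧ x 0 + x 1 ≤ M} * Literature.NumberTheory.Sieve.singularProduct (![⟨![1, 0], 0⟩, ⟨![1, 0], 2⟩, ⟨![0, 1], 0⟩, ⟨![0, 1], 2⟩, ⟨![-1, -1], (M : ℤ)⟩, ⟨![-1, -1], (M : ℤ) + 2⟩] : Fin 6 → Literature.NumberTheory.Sieve.AffLinForm 2)| ≤ ε * (M : ℝ) ^ 2

/-- item stmt-Parity-13157 · assembly · rank 1 · open · by planner
sources: GreenTao2010, VaughanHL1997, GreenTao2006Restriction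
[assembly] TupleMinorArcUniformity → BoundedDickson → RankOneTransference → ResidualLift →
GeneralizedHardyLittlewood (Vinogradov for prime tuples and fixed-system Hardy–Littlewood give the
rank-one cluster family by linear transference; the declared residual lifts it to Conj. 1.2). Proof:
`fun hV hB hR hL => hL (hR hV hB)`. -/
@[route_item "route-Parity-TwinMinorArcs"]
def Assembly : Prop :=
  TupleMinorArcUniformity → BoundedDickson → RankOneTransference → ResidualLift → GeneralizedHardyLittlewood

/-! D-0027 §2.1 — DECIDING THEOREM (planner-authored via `route open/edit --closes-file`; by planner-plancard-Parity-GeneralizedHardyLittl-ab396bfa-g2-0 2026-08-15T19:00:30Z):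
its hypotheses are this route's items and its conclusion the sub-problem Statement (glue_lint), and it elaborates with this file. -/

/-- D-0027 §2.1 deciding theorem of route TwinMinorArcs: Vinogradov for prime tuples
(`TupleMinorArcUniformity`) and fixed-system Hardy–Littlewood (`BoundedDickson`) give Green–Tao's
Conj. 1.2 for the rank-one cluster family by the provable linear transference
(`RankOneTransference`); the declared GHL-hard residual (`ResidualLift`: nil-tower for cluster
configurations of complexity ≥ 2 and the shift-uniformity lift) carries it to the sub-problem
Statement. -/
@[closes "route-Parity-TwinMinorArcs"] theorem closes (hV : TupleMinorArcUniformity) (hB : BoundedDickson) (hR : RankOneTransference)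
    (hL : ResidualLift) : GeneralizedHardyLittlewood :=
  hL (hR hV hB)

end Summit.Parity.GeneralizedHardyLittlewood.Theses.TwinMinorArcs
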